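import Summits.AtomisticToContinuum.HydrodynamicLimit.Theorems.InformationPercolationEngineKineticClosureDensity

/-!
# `ParityInBand` (route JParityClosure): the DENSITY third of its conclusion, and the Dirac density marginal, from `DensityCap` alone

Helper for the support item `JParityClosure.ParityInBand` (stmt-AtomisticToContinuum-13088, the route's typed glue
`OddContactSymmetry → … → HsEosLowDensity → HydroLimitInBand`). The conclusion asks, at every `t < T`, for convergence in
probability of the three empirical fields (density, momentum, energy). Two facts, both consequences of the single
hypothesis `DensityCap` (the one-sided "no overcompression" cap, `N → ∞` at fixed mollification radius `r`, then `r → 0`)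
together with conserved unit mass (`∫ ρ̄ʳ = 1 = ∫ ρ(s)`):

* `parityInBand_densityField_of_densityCap` — the DENSITY conjunct of the conclusion holds at EVERY `t ∈ [0,T)` for every
  tied classical solution, with no packing guard and no kinetic input (the route's `DensityCap` is verbatim the one of
  route InformationPercolationEngine, so this is `KineticClosureDensity.tendsto_densityField_of_densityCap` re-addressed);
* `densityCap_mollDensity_L1` — the `L¹` form consumed by step (iv) of the intended proof: for every `t < T` and
  `η, δ > 0`, for `r < r₀(η, δ)` and `N ≥ N₀(r)`, with probability `≥ 1 − δ` the `r`-mollified empirical density is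
  `η`-close in `L¹(𝕋³)` to `ρ(s, ·)` SIMULTANEOUSLY for all `s ∈ [0, t]`. Hence the density marginal of any Young-measure
  limit of the mollified empirical fields is the Dirac mass at `ρ(s,x) ≥ min ρ > 0` for a.e. `(s,x)`: the vacuum
  hypothesis of the in-tree Březina–Feireisl engine (`brezinaFeireisl2018_thm_3_3`, Young measure carried by `{ρ > 0}`)
  needs NO extra `DensityFloor` item — recorded for the planner's restatement of the glue.

What this does NOT give: the momentum and energy conjuncts (see the item's notes: fixed-`t` energy needs cubic tails
`EnergyCurrentTails` and the collisional energy-transfer mark; the BF18 engine consumes RENORMALISED entropy inequalities).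
prover-pitem-stmt-AtomisticToContinuum-13088-1.
-/

noncomputable section

namespace Summit.AtomisticToContinuum.HydrodynamicLimit.Theorems.ParityInBandDensity

open MeasureTheory Filter Set Topology
open scoped ENNReal
open Literature.MathematicalPhysics.KineticTheory Literature.Analysis.FluidPDE
open Literature.Analysis.FunctionSpaces
open Summit.AtomisticToContinuum.HydrodynamicLimit.Theorems.DensityCapNegative
  (mollDensity capEvent CapLimit integral_mollDensity_eq_one integrable_mollDensity densityCap_iff)
open Summit.AtomisticToContinuum.HydrodynamicLimit.Theorems.DenseExcursionEverywhere
  (integral_density_eq integral_density_zero_eq_one)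
open Summit.AtomisticToContinuum.HydrodynamicLimit.Theorems.KineticClosureDensity
  (integral_abs_sub_le_of_le_add tendsto_densityField_of_densityCap)

/-- **`DensityCap` ⟹ the density third of `ParityInBand`'s conclusion, at every `t < T`, unguarded.** For all continuous
positive profiles there is `σ₀ > 0` such that for `0 < σ < σ₀`, every classical hard-sphere-Euler solution on `[0,T)`,
every flow family and every `t = 0` tie, the empirical density field at every `t ∈ [0,T)` tested against any continuous
`χ` converges in probability to `∫ χ ρ(t)` (the route's `DensityCap` is syntactically the one of route
InformationPercolationEngine; `KineticClosureDensity.tendsto_densityField_of_densityCap`). [folklore] -/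
theorem parityInBand_densityField_of_densityCap
    (hD : Summit.AtomisticToContinuum.HydrodynamicLimit.Theses.JParityClosure.DensityCap)
    (a₀ θ₀ : T3 → ℝ) (u₀ : T3 → V3) (ha : Continuous a₀) (hθ : Continuous θ₀) (hu : Continuous u₀)
    (ha0 : ∀ x, 0 < a₀ x) (hθ0 : ∀ x, 0 < θ₀ x) :
    ∃ σ₀ : ℝ, 0 < σ₀ ∧ ∀ σ : ℝ, 0 < σ → σ < σ₀ →
      ∀ (T : ℝ) (ρ θ : ℝ → T3 → ℝ) (u : ℝ → T3 → V3), IsHardSphereEulerSolution σ T ρ u θ →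
        ∀ Φ : (N : ℕ) → HardSphereFlow (Torus.geometry (Fin 3)) (hsDiameter σ N) (N + 1),
          TendstoHydroFieldsAt (fun N => localGibbsLaw σ a₀ u₀ θ₀ N (Φ N)) Φ ρ u θ 0 →
            ∀ t ∈ Ico 0 T, ∀ χ : T3 → ℝ, Continuous χ → ∀ δ > (0 : ℝ),
              Tendsto (fun N => localGibbsLaw σ a₀ u₀ θ₀ N (Φ N)
                {z | δ < |empiricalDensityField ((Φ N).flow t z) χ - ∫ x, χ x * ρ t x|}) atTop (𝓝 0) :=
  tendsto_densityField_of_densityCap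
    (show Summit.AtomisticToContinuum.HydrodynamicLimit.Theses.InformationPercolationEngine.DensityCap from hD)
    a₀ θ₀ u₀ ha hθ hu ha0 hθ0

/-- **`DensityCap` ⟹ `L¹` convergence of the mollified empirical density, uniformly in `s ≤ t` (Dirac density marginal).**
For all continuous positive profiles there is `σ₀ > 0` (the cap's threshold cut at `1/2`) such that for `0 < σ < σ₀`, every
classical solution on `[0,T)`, every flow family, every `t = 0` tie, every `t ∈ [0,T)` and `η, δ > 0`: there is `r₀ > 0`
such that for `0 < r < r₀` and `N ≥ N₀(r)` the event "for some `s ∈ [0,t]`, `∫ |ρ̄ʳ(Φ_s z) − ρ(s,·)| > η`" has local-Gibbs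
probability `≤ δ`. Proof: off the overshoot event of the cap at level `η/3` the mollified density is `≤ ρ(s) + η/3`
everywhere; both have unit mass (`integral_mollDensity_eq_one`, `integral_density_eq`, `integral_density_zero_eq_one`), so
the one-sided bound is an `L¹` bound `2η/3 < η` (`integral_abs_sub_le_of_le_add`). [folklore] -/
theorem densityCap_mollDensity_L1
    (hD : Summit.AtomisticToContinuum.HydrodynamicLimit.Theses.JParityClosure.DensityCap)
    (a₀ θ₀ : T3 → ℝ) (u₀ : T3 → V3) (ha : Continuous a₀) (hθ : Continuous θ₀) (hu : Continuous u₀)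
    (ha0 : ∀ x, 0 < a₀ x) (hθ0 : ∀ x, 0 < θ₀ x) :
    ∃ σ₀ : ℝ, 0 < σ₀ ∧ ∀ σ : ℝ, 0 < σ → σ < σ₀ →
      ∀ (T : ℝ) (ρ θ : ℝ → T3 → ℝ) (u : ℝ → T3 → V3), IsHardSphereEulerSolution σ T ρ u θ →
        ∀ Φ : (N : ℕ) → HardSphereFlow (Torus.geometry (Fin 3)) (hsDiameter σ N) (N + 1),
          TendstoHydroFieldsAt (fun N => localGibbsLaw σ a₀ u₀ θ₀ N (Φ N)) Φ ρ u θ 0 →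
            ∀ t ∈ Ico 0 T, ∀ η δ : ℝ, 0 < η → 0 < δ →
              ∃ r₀ : ℝ, 0 < r₀ ∧ ∀ r : ℝ, 0 < r → r < r₀ → ∃ N₀ : ℕ, ∀ N : ℕ, N₀ ≤ N →
                localGibbsLaw σ a₀ u₀ θ₀ N (Φ N)
                  {z | ∃ s ∈ Icc 0 t, η < ∫ x, |mollDensity r ((Φ N).flow s z) x - ρ s x|} ≤ ENNReal.ofReal δ := by
  have hD' := densityCap_iff.1 hD
  obtain ⟨σ₁, hσ₁, H⟩ := hD' a₀ θ₀ u₀ ha hθ hu ha0 hθ0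
  refine ⟨min σ₁ (1 / 2), lt_min hσ₁ (by norm_num), fun σ hσ hσlt T ρ θ u hE Φ hA t ht η δ hη hδ => ?_⟩
  have hσ₁' : σ < σ₁ := hσlt.trans_le (min_le_left _ _)
  have hσ2 : σ ≤ 1 / 2 := (hσlt.trans_le (min_le_right _ _)).le
  have hcap : CapLimit σ a₀ u₀ θ₀ Φ ρ t := H σ hσ hσ₁' T ρ θ u hE Φ hA t ht
  obtain ⟨r₀, hr₀, Hr⟩ := hcap (η / 3) δ (by positivity) hδ
  refine ⟨min r₀ (1 / 2), lt_min hr₀ (by norm_num), fun r hr hrlt => ?_⟩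
  have hrr₀ : r < r₀ := hrlt.trans_le (min_le_left _ _)
  have hr2 : r ≤ 1 / 2 := (hrlt.trans_le (min_le_right _ _)).le
  obtain ⟨N₀, HN⟩ := Hr r hr hrr₀
  refine ⟨N₀, fun N hN => (measure_mono ?_).trans (HN N hN)⟩
  -- the `L¹`-deviation event is contained in the overshoot event
  rintro z ⟨s, hs, hz⟩
  by_contra hzc
  have hsT : s ∈ Ico 0 T := ⟨hs.1, hs.2.trans_lt ht.2⟩
  have hle : ∀ x, mollDensity r ((Φ N).flow s z) x ≤ ρ s x + η / 3 := fun x =>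
    not_lt.1 fun h => hzc ⟨s, hs, x, h⟩
  set w := (Φ N).flow s z with hw
  have hmass : ∫ x, ρ s x = 1 :=
    (integral_density_eq hE hsT).trans (integral_density_zero_eq_one hσ2 ha hθ hu ha0 hθ0 Φ hA)
  have hρcont : Continuous (ρ s) := (hE.smooth_density.isSmooth_slice hsT).continuous
  have hρint : Integrable (ρ s) volume := integrable_of_continuous_T3 hρcont
  have hL1 : ∫ x, |mollDensity r w x - ρ s x| ≤ 2 * (η / 3) :=
    integral_abs_sub_le_of_le_add (integrable_mollDensity hr w) hρint
      (by rw [integral_mollDensity_eq_one hr hr2 (Nat.succ_ne_zero N) w, hmass]) hle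
  have hz' : η < ∫ x, |mollDensity r w x - ρ s x| := hz
  linarith

/-- **Corollary (fixed time, `L¹`).** The same at the single time `s = t`: the density marginal of every limit law of the
`r`-mollified empirical density at time `t` is the point mass at `ρ(t, ·)`, in the `N → ∞` then `r → 0` order. [folklore] -/
theorem densityCap_mollDensity_L1_at
    (hD : Summit.AtomisticToContinuum.HydrodynamicLimit.Theses.JParityClosure.DensityCap)
    (a₀ θ₀ : T3 → ℝ) (u₀ : T3 → V3) (ha : Continuous a₀) (hθ : Continuous θ₀) (hu : Continuous u₀)
    (ha0 : ∀ x, 0 < a₀ x) (hθ0 : ∀ x, 0 < θ₀ x) :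
    ∃ σ₀ : ℝ, 0 < σ₀ ∧ ∀ σ : ℝ, 0 < σ → σ < σ₀ →
      ∀ (T : ℝ) (ρ θ : ℝ → T3 → ℝ) (u : ℝ → T3 → V3), IsHardSphereEulerSolution σ T ρ u θ →
        ∀ Φ : (N : ℕ) → HardSphereFlow (Torus.geometry (Fin 3)) (hsDiameter σ N) (N + 1),
          TendstoHydroFieldsAt (fun N => localGibbsLaw σ a₀ u₀ θ₀ N (Φ N)) Φ ρ u θ 0 →
            ∀ t ∈ Ico 0 T, ∀ η δ : ℝ, 0 < η → 0 < δ →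
              ∃ r₀ : ℝ, 0 < r₀ ∧ ∀ r : ℝ, 0 < r → r < r₀ → ∃ N₀ : ℕ, ∀ N : ℕ, N₀ ≤ N →
                localGibbsLaw σ a₀ u₀ θ₀ N (Φ N)
                  {z | η < ∫ x, |mollDensity r ((Φ N).flow t z) x - ρ t x|} ≤ ENNReal.ofReal δ := by
  obtain ⟨σ₀, hσ₀, H⟩ := densityCap_mollDensity_L1 hD a₀ θ₀ u₀ ha hθ hu ha0 hθ0
  refine ⟨σ₀, hσ₀, fun σ hσ hσlt T ρ θ u hE Φ hA t ht η δ hη hδ => ?_⟩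
  obtain ⟨r₀, hr₀, Hr⟩ := H σ hσ hσlt T ρ θ u hE Φ hA t ht η δ hη hδ
  refine ⟨r₀, hr₀, fun r hr hrlt => ?_⟩
  obtain ⟨N₀, HN⟩ := Hr r hr hrlt
  refine ⟨N₀, fun N hN => (measure_mono ?_).trans (HN N hN)⟩
  intro z hz
  exact ⟨t, ⟨ht.1, le_rfl⟩, hz⟩

/-- **The density third of `ParityInBand`'s conclusion, in the conclusion's own (packing-guarded) shape.** With ANY
`η₀ > 0` (here `1`; the guard is not used) and the cap's `σ₀`: for `0 < σ < σ₀`, every classical solution on `[0,T)`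
in the band, every flow family and every `t = 0` tie, the DENSITY component of `TendstoHydroFieldsAt … t` holds at every
`t ∈ [0,T)`. What remains of the glue is exactly the momentum and energy components. [folklore] -/
theorem parityInBand_conclusion_densityThird
    (hD : Summit.AtomisticToContinuum.HydrodynamicLimit.Theses.JParityClosure.DensityCap) :
    ∃ η₀ : ℝ, 0 < η₀ ∧ ∀ (a₀ θ₀ : T3 → ℝ) (u₀ : T3 → V3), Continuous a₀ → Continuous θ₀ → Continuous u₀ →
      (∀ x, 0 < a₀ x) → (∀ x, 0 < θ₀ x) → ∃ σ₀ : ℝ, 0 < σ₀ ∧ ∀ σ : ℝ, 0 < σ → σ < σ₀ →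
        ∀ (T : ℝ) (ρ θ : ℝ → T3 → ℝ) (u : ℝ → T3 → V3), IsHardSphereEulerSolution σ T ρ u θ →
          (∀ t ∈ Ico 0 T, ∀ x, ρ t x * σ ^ 3 < η₀) →
            ∀ Φ : (N : ℕ) → HardSphereFlow (Torus.geometry (Fin 3)) (hsDiameter σ N) (N + 1),
              TendstoHydroFieldsAt (fun N => localGibbsLaw σ a₀ u₀ θ₀ N (Φ N)) Φ ρ u θ 0 →
                ∀ t ∈ Ico 0 T, ∀ χ : T3 → ℝ, Continuous χ → ∀ δ > (0 : ℝ),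
                  Tendsto (fun N => localGibbsLaw σ a₀ u₀ θ₀ N (Φ N)
                    {z | δ < |empiricalDensityField ((Φ N).flow t z) χ - ∫ x, χ x * ρ t x|}) atTop (𝓝 0) := by
  refine ⟨1, one_pos, fun a₀ θ₀ u₀ ha hθ hu ha0 hθ0 => ?_⟩
  obtain ⟨σ₀, hσ₀, H⟩ := parityInBand_densityField_of_densityCap hD a₀ θ₀ u₀ ha hθ hu ha0 hθ0
  exact ⟨σ₀, hσ₀, fun σ hσ hσlt T ρ θ u hE _ Φ hA => H σ hσ hσlt T ρ θ u hE Φ hA⟩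

end Summit.AtomisticToContinuum.HydrodynamicLimit.Theorems.ParityInBandDensity

end
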